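import Summits.HodgeConjecture.CorCM.MultiFieldWeilDihedralFiveCriterion
import Summits.HodgeConjecture.CorCM.MultiFieldWeilPrimeTower
import HarnessLib

/-!
# MULTI-FIELD WEIL ENGINE — THE DIHEDRAL IMAGE: a transitive set of permutations of five letters, closed under products and inverses, with AT MOST TEN elements and a
# non-identity element fixing a letter, IS a dihedral group `g D₅ g⁻¹`; hence the separation property of a unit of `2`-sets read through such an image (census level)

Cell `pub-hodgecm2` (COR-CM), seat b30 gen 42 (2026-08-26); count-neutral own lane MULTI-FIELD WEIL ENGINE (stem `MultiFieldWeil*`), census level, the sequel of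
`CorCM/MultiFieldWeilDihedralFive{,Criterion}.lean`.  Theorems only; no definition, no named fact, no `sorry`, no `decide` beyond numerals of `Fin 5`.  HONEST FRAMING: finite
group theory of `Sym(5)`; `HC_CM` is NOT touched.

THE POINT.  The realised tuples of a decic CM field `K ∋ k` act on the five `τ`-embeddings through a transitive set `H ⊆ Sym(5)` closed under products and inverses; when the
Galois closure of `K` has degree `20` this set has at most `10` elements, and a `τ`-embedding with a value outside the image of another gives a non-identity element with a fixed
letter.  THIS FILE turns exactly that data into the ten dihedral maps:
* §1 `addRight_mem_of_finRotate_mem`: with the rotation `finRotate 5` all rotations `x ↦ x + t` lie in `H`;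
* §2 **`subLeft_mem_of_card_le_ten`**: `H` closed under products, `finRotate 5 ∈ H`, `|H| ≤ 10`, and some `σ ∈ H`, `σ ≠ 1`, fixing a letter ⟹ every reflection `x ↦ t − x` lies
  in `H` (ELEMENTARY: normalise `σ(0) = 0`; the ten maps `x ↦ x + t`, `x ↦ σ(x) + t` are distinct, so they exhaust `H`; then `σ ∘ (x ↦ x+1) = (x ↦ x + t) ∘ σ` forces `σ(x) = t·x`,
  and `σ² ∈ H` fixing `0` forces `σ² = 1`, `t² = 1`, `t = −1`);
* §3 **`exists_conj_dihedral`**: `H` closed under products and inverses, transitive, `|H| ≤ 10`, with a non-identity element fixing a letter ⟹ for some `g ∈ Sym(5)` all ten maps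
  `g (x ↦ x + t) g⁻¹`, `g (x ↦ t − x) g⁻¹` lie in `H` (`|H| = 10` by counting `h_b`, `h_b σ`; Cauchy gives an element of order `5`, a conjugate of `finRotate 5` by
  `exists_conj_finRotate_of_orderOf_eq_prime`; then §2 in `g⁻¹ H g`);
* §4 **`const_of_signed_of_dihedral_image`** — THE SEPARATION PROPERTY OF A DIHEDRAL UNIT: under §3's hypotheses, at most two position sets of size `2` such that NO non-identity
  element of `H` stabilises all of them (`hfree`) have only constant solutions of their signed equations over `H` (`fIndependent_pairs_of_sum_ne` in the frame `g`, then
  `const_of_signed_dihedral_five_conj`);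
* §5 `const_of_signed_of_equiv`: transport of the separation property along `Fin k ≃ Fin k'` (the realised slots have size `n m = 5` only propositionally).
[cite: DixonMortimer1996, §1.4 Ex. 1.4.1–1.4.2; §1.6, Thm. 1.6A; §2.1; §3.3] [cite: Serre1977, §5.3] [cite: Lang2002, I §6 (Cauchy), XIII §4]

## References
* [DixonMortimer1996] J. D. Dixon, B. Mortimer, *Permutation Groups*, GTM 163, §1.4, §1.6 (Thm. 1.6A), §2.1, §3.3.
* [Serre1977] J.-P. Serre, *Linear Representations of Finite Groups*, GTM 42, §5.3.
* [Lang2002] S. Lang, *Algebra*, GTM 211, I §6, XIII §4.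
-/

noncomputable section

namespace Summit.HodgeConjecture.CorCM.MultiFieldWeil

open Finset
open Fin.CommRing

open scoped Classical

section Image

variable {H : Finset (Equiv.Perm (Fin 5))}

/-! ## §1 Rotations from one rotation -/

/-- Powers of the standard rotation: `(finRotate 5)^j (x) = x + j`. [folklore] -/
theorem finRotate_five_pow_apply (j : ℕ) (x : Fin 5) : ((finRotate 5) ^ j) x = x + (j : Fin 5) := by
  induction j with
  | zero => simp
  | succ j ih => rw [pow_succ', Equiv.Perm.mul_apply, ih, finRotate_apply, Nat.cast_succ, add_assoc]

/-- **All rotations from one.**  `H ⊆ Sym(5)` closed under products with `finRotate 5 ∈ H` contains every rotation `x ↦ x + t`. [cite: DixonMortimer1996, §1.6] -/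
theorem addRight_mem_of_finRotate_mem (hmul : ∀ σ ∈ H, ∀ σ' ∈ H, σ * σ' ∈ H) (hrot : finRotate 5 ∈ H) (t : Fin 5) : Equiv.addRight t ∈ H := by
  have hpow : ∀ j : ℕ, (finRotate 5) ^ (j + 1) ∈ H := by
    intro j
    induction j with
    | zero => rw [zero_add, pow_one]; exact hrot
    | succ j ih => rw [pow_succ]; exact hmul _ ih _ hrot
  have heq : (finRotate 5) ^ (t.val + 4 + 1) = Equiv.addRight t := by
    refine Equiv.ext fun x => ?_
    rw [finRotate_five_pow_apply, Equiv.coe_addRight]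
    congr 2
    rw [Nat.cast_add, Nat.cast_add, Fin.cast_val_eq_self]
    have : ((4 : ℕ) : Fin 5) + ((1 : ℕ) : Fin 5) = 0 := by decide
    rw [add_assoc, this, add_zero]
  rw [← heq]
  exact hpow _

/-! ## §2 Reflections from the count -/

/-- **A TRANSITIVE SET OF PERMUTATIONS OF FIVE LETTERS OF ORDER AT MOST TEN, CONTAINING THE ROTATION AND A NON-IDENTITY ELEMENT WITH A FIXED LETTER, CONTAINS EVERY
REFLECTION `x ↦ t − x`.**  See the module docstring for the elementary proof. [cite: DixonMortimer1996, §1.6, Thm. 1.6A; §3.3] [cite: Serre1977, §5.3] -/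
theorem subLeft_mem_of_card_le_ten (hmul : ∀ σ ∈ H, ∀ σ' ∈ H, σ * σ' ∈ H) (hrot : finRotate 5 ∈ H) (hcard : H.card ≤ 10)
    {σ₀ : Equiv.Perm (Fin 5)} (hσ₀ : σ₀ ∈ H) (hσ₀1 : σ₀ ≠ 1) {a₀ : Fin 5} (ha₀ : σ₀ a₀ = a₀) (t : Fin 5) : Equiv.subLeft t ∈ H := by
  have hR : ∀ t : Fin 5, Equiv.addRight t ∈ H := addRight_mem_of_finRotate_mem hmul hrot
  -- normalise: `σ` fixes `0`
  set σ : Equiv.Perm (Fin 5) := Equiv.addRight (-a₀) * σ₀ * Equiv.addRight a₀ with hσdef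
  have hσ : σ ∈ H := hmul _ (hmul _ (hR _) _ hσ₀) _ (hR _)
  have hσ0 : σ 0 = 0 := by
    show σ₀ (0 + a₀) + -a₀ = 0
    rw [zero_add, ha₀, add_neg_cancel]
  have hσ1 : σ ≠ 1 := by
    intro h
    apply hσ₀1
    have : σ₀ = Equiv.addRight a₀ * σ * Equiv.addRight (-a₀) := by
      rw [hσdef]; exact Equiv.ext fun x => by simp
    rw [this, h, mul_one]
    exact Equiv.ext fun x => by simp
  have hσne : ∀ t : Fin 5, σ ≠ Equiv.addRight t := by
    intro t h
    have h0 : t = 0 := by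
      have e := congrArg (fun π : Equiv.Perm (Fin 5) => π 0) h
      simp only [hσ0, Equiv.coe_addRight, zero_add] at e
      exact e.symm
    apply hσ1
    rw [h, h0]
    exact Equiv.ext fun x => add_zero x
  -- the ten elements `x ↦ x + t`, `x ↦ σ x + t`
  set F : Fin 5 × Bool → Equiv.Perm (Fin 5) := fun p => if p.2 then Equiv.addRight p.1 * σ else Equiv.addRight p.1 with hF
  have hFinj : Function.Injective F := by
    rintro ⟨t, b⟩ ⟨t', b'⟩ h
    have h0 := congrArg (fun π : Equiv.Perm (Fin 5) => π 0) h
    cases b <;> cases b' <;> simp only [hF, if_true, Equiv.Perm.mul_apply, Equiv.coe_addRight, hσ0, zero_add, Bool.false_eq_true,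
      if_false] at h h0
    · rw [h0]
    · exfalso
      rw [h0] at h
      exact hσ1 (mul_left_cancel (a := Equiv.addRight t') (by rw [mul_one]; exact h.symm))
    · exfalso
      rw [h0] at h
      exact hσ1 (mul_left_cancel (a := Equiv.addRight t') (by rw [mul_one]; exact h))
    · rw [h0]
  have hFmem : ∀ p, F p ∈ H := by
    rintro ⟨t, b⟩
    cases b
    · simp only [hF, Bool.false_eq_true, if_false]; exact hR t
    · simp only [hF, if_true]; exact hmul _ (hR t) _ hσ
  have hSH : (Finset.univ.image F) = H := by
    refine Finset.eq_of_subset_of_card_le (fun π hπ => ?_) ?_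
    · obtain ⟨p, -, rfl⟩ := Finset.mem_image.1 hπ
      exact hFmem p
    · rw [Finset.card_image_of_injective _ hFinj, Finset.card_univ, Fintype.card_prod, Fintype.card_fin, Fintype.card_bool]
      exact hcard
  have hmemS : ∀ π ∈ H, ∃ t : Fin 5, π = Equiv.addRight t ∨ π = Equiv.addRight t * σ := by
    intro π hπ
    rw [← hSH] at hπ
    obtain ⟨⟨t, b⟩, -, rfl⟩ := Finset.mem_image.1 hπ
    cases b
    · exact ⟨t, Or.inl (by simp only [hF, Bool.false_eq_true, if_false])⟩
    · exact ⟨t, Or.inr (by simp only [hF, if_true])⟩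
  -- `σ ∘ (x ↦ x + 1) = (x ↦ x + t₁) ∘ σ`
  obtain ⟨t₁, ht₁⟩ : ∃ t₁ : Fin 5, ∀ x, σ (x + 1) = σ x + t₁ := by
    obtain ⟨t, h | h⟩ := hmemS _ (hmul _ hσ _ (hR 1))
    · exfalso
      apply hσne (t - 1)
      refine Equiv.ext fun x => ?_
      have := congrArg (fun π : Equiv.Perm (Fin 5) => π (x - 1)) h
      simp only [Equiv.Perm.mul_apply, Equiv.coe_addRight, sub_add_cancel] at this
      rw [this]
      show x - 1 + t = x + (t - 1)
      ring
    · refine ⟨t, fun x => ?_⟩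
      have := congrArg (fun π : Equiv.Perm (Fin 5) => π x) h
      simpa only [Equiv.Perm.mul_apply, Equiv.coe_addRight] using this
  -- `σ x = t₁ x`
  have hσmul : ∀ x : Fin 5, σ x = t₁ * x := by
    have hnat : ∀ j : ℕ, σ (j : Fin 5) = t₁ * (j : Fin 5) := by
      intro j
      induction j with
      | zero => rw [Nat.cast_zero, hσ0, mul_zero]
      | succ j ih => rw [Nat.cast_succ, ht₁, ih]; ring
    intro x
    have := hnat x.val
    rwa [Fin.cast_val_eq_self] at this
  -- `σ² = 1`
  have hσσ : σ * σ = 1 := by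
    obtain ⟨t, h | h⟩ := hmemS _ (hmul _ hσ _ hσ)
    · have h0 := congrArg (fun π : Equiv.Perm (Fin 5) => π 0) h
      simp only [Equiv.Perm.mul_apply, hσ0, Equiv.coe_addRight, zero_add] at h0
      rw [h, ← h0]
      exact Equiv.ext fun x => add_zero x
    · exfalso
      have h0 := congrArg (fun π : Equiv.Perm (Fin 5) => π 0) h
      simp only [Equiv.Perm.mul_apply, hσ0, Equiv.coe_addRight, zero_add] at h0
      rw [← h0] at h
      apply hσ1
      have h' : σ * σ = σ * 1 := by
        rw [mul_one, h]
        exact Equiv.ext fun x => by simp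
      exact mul_left_cancel h'
  have ht₁sq : t₁ * t₁ = 1 := by
    have := congrArg (fun π : Equiv.Perm (Fin 5) => π 1) hσσ
    simp only [Equiv.Perm.mul_apply, Equiv.Perm.one_apply, hσmul, mul_one] at this
    exact this
  have ht₁ne : t₁ ≠ 1 := by
    intro h
    apply hσ1
    exact Equiv.ext fun x => by rw [hσmul, h, one_mul]; rfl
  have ht₁4 : t₁ = 4 := by
    revert ht₁sq ht₁ne
    fin_cases t₁ <;> decide
  -- the reflections
  have heq : Equiv.subLeft t = Equiv.addRight t * σ := by
    refine Equiv.ext fun x => ?_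
    rw [Equiv.Perm.mul_apply, Equiv.coe_addRight, hσmul, ht₁4, Equiv.subLeft_apply]
    linear_combination (-x) * five_eq_zero_fin
  rw [heq]
  exact hmul _ (hR t) _ hσ

/-! ## §3 The dihedral image -/

/-- **A TRANSITIVE CLOSED SET OF AT MOST TEN PERMUTATIONS OF FIVE LETTERS WITH A NON-IDENTITY ELEMENT FIXING A LETTER IS A DIHEDRAL GROUP**: for some `g ∈ Sym(5)` all ten maps
`g (x ↦ x + t) g⁻¹`, `g (x ↦ t − x) g⁻¹` lie in `H` (and exhaust it).  `|H| = 10` by counting; Cauchy's theorem in the subgroup `H` gives an element of order `5`, conjugate to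
`finRotate 5`; then `subLeft_mem_of_card_le_ten` in `g⁻¹ H g`. [cite: DixonMortimer1996, §1.6, Thm. 1.6A; §3.3] [cite: Lang2002, I §6] -/
theorem exists_conj_dihedral (hmul : ∀ σ ∈ H, ∀ σ' ∈ H, σ * σ' ∈ H) (hinv : ∀ σ ∈ H, σ⁻¹ ∈ H) (hne : H.Nonempty) (hcard : H.card ≤ 10)
    (htrans : ∀ a b : Fin 5, ∃ σ ∈ H, σ a = b) (hfix : ∃ σ ∈ H, σ ≠ 1 ∧ ∃ a, σ a = a) :
    ∃ g : Equiv.Perm (Fin 5), ∀ t : Fin 5, g * Equiv.addRight t * g⁻¹ ∈ H ∧ g * Equiv.subLeft t * g⁻¹ ∈ H := by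
  obtain ⟨σ₀, hσ₀, hσ₀1, a₀, ha₀⟩ := hfix
  have h1 : (1 : Equiv.Perm (Fin 5)) ∈ H := one_mem_perm_of_closed hmul hinv hne
  -- `|H| = 10`
  choose hb hbmem hbval using fun b => htrans a₀ b
  have hcard10 : H.card = 10 := by
    refine le_antisymm hcard ?_
    set F : Fin 5 × Bool → Equiv.Perm (Fin 5) := fun p => if p.2 then hb p.1 * σ₀ else hb p.1 with hF
    have hFinj : Function.Injective F := by
      rintro ⟨b, c⟩ ⟨b', c'⟩ h
      have h0 := congrArg (fun π : Equiv.Perm (Fin 5) => π a₀) h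
      cases c <;> cases c' <;> simp only [hF, if_true, Equiv.Perm.mul_apply, ha₀, hbval, Bool.false_eq_true, if_false] at h h0
      · rw [h0]
      · exfalso; subst h0
        exact hσ₀1 (mul_left_cancel (a := hb b) (by rw [mul_one]; exact h.symm))
      · exfalso; subst h0
        exact hσ₀1 (mul_left_cancel (a := hb b) (by rw [mul_one]; exact h))
      · rw [h0]
    have hsub : Finset.univ.image F ⊆ H := fun π hπ => by
      obtain ⟨⟨b, c⟩, -, rfl⟩ := Finset.mem_image.1 hπ
      cases c
      · simp only [hF, Bool.false_eq_true, if_false]; exact hbmem b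
      · simp only [hF, if_true]; exact hmul _ (hbmem b) _ hσ₀
    have := Finset.card_le_card hsub
    rwa [Finset.card_image_of_injective _ hFinj, Finset.card_univ, Fintype.card_prod, Fintype.card_fin, Fintype.card_bool] at this
  -- Cauchy: an element of order `5`
  let Hs : Subgroup (Equiv.Perm (Fin 5)) :=
    { carrier := {σ | σ ∈ H}
      mul_mem' := fun {σ₁ σ₂} h₁ h₂ => hmul σ₁ h₁ σ₂ h₂
      one_mem' := h1
      inv_mem' := fun {σ} h => hinv σ h }
  have hcardHs : Nat.card Hs = 10 := by
    rw [← hcard10]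
    exact Nat.card_eq_finsetCard H
  haveI : Fact (Nat.Prime 5) := ⟨by norm_num⟩
  obtain ⟨ρ, hρ⟩ := exists_prime_orderOf_dvd_card' (G := Hs) 5 (by rw [hcardHs]; norm_num)
  have hρord : orderOf (ρ : Equiv.Perm (Fin 5)) = 5 := by rw [Subgroup.orderOf_coe, hρ]
  obtain ⟨g, hg⟩ := exists_conj_finRotate_of_orderOf_eq_prime (by norm_num) (ρ : Equiv.Perm (Fin 5)) hρord
  have hρmem : g * finRotate 5 * g⁻¹ ∈ H := by rw [hg]; exact ρ.2
  -- the conjugated set `H' = g⁻¹ H g`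
  set H' : Finset (Equiv.Perm (Fin 5)) := H.image fun σ => g⁻¹ * σ * g with hH'
  have hmemH' : ∀ π, π ∈ H' ↔ g * π * g⁻¹ ∈ H := fun π => by
    rw [hH', Finset.mem_image]
    constructor
    · rintro ⟨σ, hσ, rfl⟩
      have : g * (g⁻¹ * σ * g) * g⁻¹ = σ := by group
      rw [this]; exact hσ
    · intro h
      exact ⟨_, h, by group⟩
  have hmul' : ∀ σ ∈ H', ∀ σ' ∈ H', σ * σ' ∈ H' := by
    intro σ hσ σ' hσ'
    rw [hmemH'] at hσ hσ' ⊢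
    have : g * (σ * σ') * g⁻¹ = (g * σ * g⁻¹) * (g * σ' * g⁻¹) := by group
    rw [this]; exact hmul _ hσ _ hσ'
  have hrot' : finRotate 5 ∈ H' := (hmemH' _).2 hρmem
  have hcard' : H'.card ≤ 10 := by
    rw [hH']
    exact (Finset.card_image_le).trans hcard
  have hσ₀' : g⁻¹ * σ₀ * g ∈ H' := by
    rw [hmemH']
    have e : g * (g⁻¹ * σ₀ * g) * g⁻¹ = σ₀ := by group
    rw [e]; exact hσ₀
  have hσ₀'1 : g⁻¹ * σ₀ * g ≠ 1 := by
    intro h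
    apply hσ₀1
    have : σ₀ = g * (g⁻¹ * σ₀ * g) * g⁻¹ := by group
    rw [this, h]; group
  have ha₀' : (g⁻¹ * σ₀ * g) (g⁻¹ a₀) = g⁻¹ a₀ := by
    have e : g (g⁻¹ a₀) = a₀ := g.apply_symm_apply a₀
    simp only [Equiv.Perm.mul_apply, e, ha₀]
  refine ⟨g, fun t => ⟨(hmemH' _).1 (addRight_mem_of_finRotate_mem hmul' hrot' t),
    (hmemH' _).1 (subLeft_mem_of_card_le_ten hmul' hrot' hcard' hσ₀' hσ₀'1 ha₀' t)⟩⟩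

/-! ## §4 The separation property of a dihedral unit -/

/-- **THE SEPARATION PROPERTY OF A DIHEDRAL UNIT OF `2`-SETS.**  `H ⊆ Sym(5)` closed under products and inverses, transitive, `|H| ≤ 10`, with a non-identity element
fixing a letter (so `H = g D₅ g⁻¹`, `exists_conj_dihedral`); at most two position sets `Q_i` of size `2` such that NO non-identity element of `H` stabilises every `Q_i`
(`hfree`).  Then every family of integer defects whose total signed sum is constant on `H` is constant: in the frame `g` the two sets have different axes, so their centred
indicators are `ℚ(√5)`-independent (`fIndependent_pairs_of_sum_ne`), and `const_of_signed_dihedral_five_conj` applies. [cite: Serre1977, §5.3]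
[cite: DixonMortimer1996, §1.6, Thm. 1.6A; §2.1] [cite: Lang2002, XIII §4] -/
theorem const_of_signed_of_dihedral_image {ι : Type} [Fintype ι] (hmul : ∀ σ ∈ H, ∀ σ' ∈ H, σ * σ' ∈ H) (hinv : ∀ σ ∈ H, σ⁻¹ ∈ H) (hne : H.Nonempty)
    (hcard : H.card ≤ 10) (htrans : ∀ a b : Fin 5, ∃ σ ∈ H, σ a = b) (hfix : ∃ σ ∈ H, σ ≠ 1 ∧ ∃ a, σ a = a)
    (hι : Fintype.card ι ≤ 2) (Q : ι → Finset (Fin 5)) (hQ : ∀ i, (Q i).card = 2)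
    (hfree : ∀ σ ∈ H, (∀ (i : ι) (x : Fin 5), σ x ∈ Q i ↔ x ∈ Q i) → σ = 1)
    (u : ι → Fin 5 → ℤ) {w : ℤ} (h : ∀ σ ∈ H, (∑ i, ∑ a : Fin 5, (if σ a ∈ Q i then u i a else -u i a)) = w)
    (i : ι) (a b : Fin 5) : u i a = u i b := by
  obtain ⟨g, hg⟩ := exists_conj_dihedral hmul hinv hne hcard htrans hfix
  -- the transported sets
  set Q' : ι → Finset (Fin 5) := fun i => (Q i).image ⇑g⁻¹ with hQ'
  have hmemQ' : ∀ (i : ι) (s : Fin 5), s ∈ Q' i ↔ g s ∈ Q i := fun i s => by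
    rw [hQ', Finset.mem_image]
    constructor
    · rintro ⟨x, hx, rfl⟩; simpa using hx
    · intro hs; exact ⟨g s, hs, by simp⟩
  have hQ'card : ∀ i, (Q' i).card = 2 := fun i => by rw [hQ', Finset.card_image_of_injective _ g⁻¹.injective, hQ i]
  set c : ι → Fin 5 → ℚ := fun i s => 5 * (if g s ∈ Q i then 1 else 0) - (Q i).card with hc
  have hc' : ∀ i s, c i s = 5 * (if s ∈ Q' i then 1 else 0) - (Q' i).card := fun i s => by
    simp only [hc, hmemQ', hQ'card, hQ]
  -- two indices are all of `ι`
  have hall : ∀ i j : ι, i ≠ j → ∀ l : ι, l = i ∨ l = j := by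
    intro i j hij l
    by_contra hl
    push Not at hl
    have h3 : ({i, j, l} : Finset ι).card = 3 := by
      rw [Finset.card_insert_of_notMem, Finset.card_pair (Ne.symm hl.2)]
      simp only [Finset.mem_insert, Finset.mem_singleton, not_or]
      exact ⟨hij, Ne.symm hl.1⟩
    have := (Finset.card_le_univ ({i, j, l} : Finset ι)).trans hι
    omega
  -- `hsum`: the axis of `Q' j` does not stabilise `Q' i`
  have hsum : ∀ i j, i ≠ j → ∀ t : Fin 5, (∀ s, Equiv.subLeft t s ∈ Q' j ↔ s ∈ Q' j) → ∃ s, ¬ (Equiv.subLeft t s ∈ Q' i ↔ s ∈ Q' i) := by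
    intro i j hij t hj
    by_contra hcon
    push Not at hcon
    have hstab : ∀ (l : ι) (x : Fin 5), (g * Equiv.subLeft t * g⁻¹) x ∈ Q l ↔ x ∈ Q l := by
      intro l x
      have key : ∀ l, (∀ s, Equiv.subLeft t s ∈ Q' l ↔ s ∈ Q' l) → ((g * Equiv.subLeft t * g⁻¹) x ∈ Q l ↔ x ∈ Q l) := fun l hl => by
        have h1 := hl (g⁻¹ x)
        rw [hmemQ', hmemQ'] at h1
        have e : g (g⁻¹ x) = x := g.apply_symm_apply x
        rw [e] at h1
        simpa only [Equiv.Perm.mul_apply] using h1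
      rcases hall i j hij l with rfl | rfl
      · exact key _ hcon
      · exact key _ hj
    have h1 := hfree _ (hg t).2 hstab
    have : Equiv.subLeft t = 1 := by
      have e : Equiv.subLeft t = g⁻¹ * (g * Equiv.subLeft t * g⁻¹) * g := by group
      rw [e, h1]; group
    -- any reflection moves a letter
    have hmove : ∃ s : Fin 5, Equiv.subLeft t s ≠ s := by
      by_cases h0 : Equiv.subLeft t 0 = (0 : Fin 5)
      · refine ⟨1, fun h1' => ?_⟩
        have e0 : t - 0 = (0 : Fin 5) := h0
        have e1 : t - 1 = (1 : Fin 5) := h1'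
        have : (2 : Fin 5) = 0 := by linear_combination e0 - e1
        exact absurd this (by decide)
      · exact ⟨0, h0⟩
    obtain ⟨s₀, hs₀⟩ := hmove
    exact hs₀ (by rw [this]; rfl)
  exact const_of_signed_dihedral_five_conj g (fun t => (hg t).1) (fun t => (hg t).2) Q u h c (fun i s => by simp only [hc])
    (fIndependent_pairs_of_sum_ne hι Q' hQ'card hsum c hc') i a b

end Image

/-! ## §5 Transport along an equivalence of the letters -/

section Transport

/-- **Separation is invariant under relabelling the letters** (`f : Fin k ≃ Fin k'`): if every solution of the signed equations of the transported system (permutations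
`f σ f⁻¹`, position sets `f Q_i`) is constant, so is every solution of the original one.  Used with `finCongr : Fin (n m) ≃ Fin 5` for a realised slot of size `5`.
[folklore] -/
theorem const_of_signed_of_equiv {k k' : ℕ} {ι : Type} [Fintype ι] (f : Fin k ≃ Fin k') (H : Finset (Equiv.Perm (Fin k))) (Q : ι → Finset (Fin k))
    (hsep : ∀ (u' : ι → Fin k' → ℤ) (w' : ℤ),
      (∀ σ ∈ H, (∑ i, ∑ a : Fin k', if f (σ (f.symm a)) ∈ (Q i).image ⇑f then u' i a else -u' i a) = w') → ∀ (i : ι) (a b : Fin k'), u' i a = u' i b)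
    (u : ι → Fin k → ℤ) {w : ℤ} (h : ∀ σ ∈ H, (∑ i, ∑ a, if σ a ∈ Q i then u i a else -u i a) = w) (i : ι) (a b : Fin k) : u i a = u i b := by
  have hmem : ∀ (i : ι) (x : Fin k), f x ∈ (Q i).image ⇑f ↔ x ∈ Q i := fun i x => by
    rw [Finset.mem_image]
    constructor
    · rintro ⟨y, hy, hxy⟩; rwa [← f.injective hxy]
    · intro hx; exact ⟨x, hx, rfl⟩
  have key := hsep (fun i a => u i (f.symm a)) w fun σ hσ => by
    rw [← h σ hσ]
    refine Finset.sum_congr rfl fun i _ => ?_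
    rw [← Equiv.sum_comp f (fun a => if f (σ (f.symm a)) ∈ (Q i).image ⇑f then u i (f.symm a) else -u i (f.symm a))]
    refine Finset.sum_congr rfl fun x _ => ?_
    simp only [Equiv.symm_apply_apply, hmem]
  have := key i (f a) (f b)
  simpa using this

end Transport

end Summit.HodgeConjecture.CorCM.MultiFieldWeil

end
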